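import Literature.MathematicalPhysics.QuantumLattice.HeisenbergOrder
import Literature.MathematicalPhysics.QuantumLattice.LatticeToriLROProofs
import HarnessLib

/-!
# Néel order along even tori: discharge of the unfolding lemma `hasStaggeredEvenTorusLRO_iff`

Sibling proof file of `Literature/MathematicalPhysics/QuantumLattice/HeisenbergOrder.lean`
(topic `MathematicalPhysics/QuantumLattice`; next to `HeisenbergOrderProofs.lean`, which discharges
the magnetisation bound and carries the operator-algebra imports). It discharges the named fact
`hasStaggeredEvenTorusLRO_iff` of that file; no statement is introduced or changed.

* `hasStaggeredEvenTorusLRO_iff_holds : hasStaggeredEvenTorusLRO_iff` — `HasStaggeredEvenTorusLRO G`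
  (Néel long-range order of a family of torus two-point functions along the even tori
  `(ℤ/2kℤ)^d`, implemented as `HasStaggeredLongRangeOrder` of the pull-back to `ℤ^d` with sign
  `latticeStagger` over the fundamental domains `halfOpenBox d (2k)`) unfolds to the textbook
  criterion `0 < liminf_k L^{-2d} Σ_{x, y ∈ (ℤ/Lℤ)^d} (-1)^{Σ xᵢ} (-1)^{Σ yᵢ} G L x y` along
  `L = 2(k + 1)`, the torus signs being computed on canonical representatives (`ZMod.val`).

This is Dyson–Lieb–Simon's finite-volume form of long-range order, §1 eq. (4), p. 337
(`lim_{Λ → ∞} ⟨(|Λ|⁻¹ Σ_α S_α)²⟩ ≠ 0`, i.e. the `|Λ|⁻²`-normalised double sum), with the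
antiferromagnetic substitution `p ↦ (π, …, π) - p` of p. 338, i.e. the staggering sign
`S_α ↦ (-1)^{|α|} S_α`, `|α| = α₁ + ⋯ + α_ν` (§6, pp. 365–366), on boxes `L₁ × ⋯ × L_ν` "with each
`Lⱼ` an even integer" (Theorems 4.1–4.2, pp. 352–353).

Architecture of the (elementary, bookkeeping) proof: the index shift `k ↦ k + 1` does not change
a `liminf` along `atTop` (`Filter.liminf_nat_add`); for every `k` the side `2(k + 1)` is rewritten
as `(2k + 1) + 1` on the (non-dependent) pull-back side, after which the volume-by-volume identity
is `staggeredSum_torusPullback_succ` of `LatticeToriLROProofs` at side `(2k + 1) + 1` (reindexing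
along the bijection `Torus.proj : halfOpenBox d L → (ℤ/Lℤ)^d`, identification of `latticeStagger`
with the torus sign on canonical representatives, and `|halfOpenBox d L|² = L^{2d}`).

## References
* [DysonLiebSimon1978] F. J. Dyson, E. H. Lieb, B. Simon, *Phase transitions in quantum spin
  systems with isotropic and nonisotropic interactions*, J. Stat. Phys. 18 (1978) 335–383, §1
  eq. (4) p. 337, p. 338; Theorems 4.1–4.2 pp. 352–353; §6 pp. 365–366.
-/

noncomputable section

open Filter Finset

namespace Literature.MathematicalPhysics.QuantumLattice

open Literature.Probability.LatticeModels

variable {d : ℕ}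

/-- The volume-by-volume identity behind `hasStaggeredEvenTorusLRO_iff` (even side
`2(k + 1) = 2k + 2 ≠ 0`): the staggered double sum of the pull-back over the fundamental domain
`halfOpenBox d (2(k+1))`, normalised by `|halfOpenBox d (2(k+1))|²`, equals the staggered double
sum over the torus `(ℤ/(2k+2)ℤ)^d` with signs on canonical representatives, normalised by
`(2k+2)^{2d}`. This is `staggeredSum_torusPullback_succ` at side `(2k + 1) + 1`.
(Dyson–Lieb–Simon 1978, §1, eq. (4) p. 337 and p. 338.) [folklore] -/
theorem staggeredSum_torusPullback_two_mul_succ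
    (G : (L : ℕ) → TorusSite d L → TorusSite d L → ℝ) (k : ℕ) :
    (∑ x ∈ halfOpenBox d (2 * (k + 1)), ∑ y ∈ halfOpenBox d (2 * (k + 1)),
        latticeStagger x * latticeStagger y * torusPullback G (2 * (k + 1)) x y) /
      ((halfOpenBox d (2 * (k + 1))).card : ℝ) ^ 2 =
    (∑ x : TorusSite d (2 * k + 2), ∑ y : TorusSite d (2 * k + 2),
        (-1 : ℝ) ^ (∑ i, (x i).val) * (-1) ^ (∑ i, (y i).val) * G (2 * k + 2) x y) /
      ((2 * k + 2 : ℕ) : ℝ) ^ (2 * d) := by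
  rw [show 2 * (k + 1) = 2 * k + 1 + 1 by ring]
  exact staggeredSum_torusPullback_succ G (2 * k + 1)

/-- **Discharge of `hasStaggeredEvenTorusLRO_iff`.** `HasStaggeredEvenTorusLRO G` is, by
definition, `HasStaggeredLongRangeOrder` of the pull-back of `G` with sign `latticeStagger` over
the fundamental domains `halfOpenBox d (2k)`; it unfolds to the textbook Néel long-range-order
criterion `0 < liminf_k L^{-2d} Σ_{x, y ∈ (ℤ/Lℤ)^d} (-1)^{Σ xᵢ} (-1)^{Σ yᵢ} G L x y` along the even
sides `L = 2(k + 1)` — Dyson–Lieb–Simon's eq. (4) of §1 (p. 337, the `|Λ|⁻²`-normalised double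
sum) with the antiferromagnetic substitution `p ↦ (π, …, π) - p` (p. 338), i.e. the sign
`(-1)^{|α|}` (§6, p. 366) on canonical representatives `αᵢ ∈ {0, …, Lᵢ - 1}`, on boxes of even
sides (Theorems 4.1–4.2, pp. 352–353). Proof: the shift `k ↦ k + 1` does not change a `liminf`
along `atTop` (`Filter.liminf_nat_add`), and the two normalised sums agree for every `k`
(`staggeredSum_torusPullback_two_mul_succ`).
[cite: DysonLiebSimon1978, §1 eq. (4), pp. 337–338; Thms 4.1–4.2, pp. 352–353] -/
theorem hasStaggeredEvenTorusLRO_iff_holds : hasStaggeredEvenTorusLRO_iff (d := d) := by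
  intro G
  have hlim :
      liminf (fun k : ℕ => (∑ x ∈ halfOpenBox d (2 * k), ∑ y ∈ halfOpenBox d (2 * k),
          latticeStagger x * latticeStagger y * torusPullback G (2 * k) x y) /
        ((halfOpenBox d (2 * k)).card : ℝ) ^ 2) atTop =
      liminf (fun k : ℕ => (∑ x : TorusSite d (2 * k + 2), ∑ y : TorusSite d (2 * k + 2),
          (-1 : ℝ) ^ (∑ i, (x i).val) * (-1) ^ (∑ i, (y i).val) * G (2 * k + 2) x y) /
        ((2 * k + 2 : ℕ) : ℝ) ^ (2 * d)) atTop :=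
    (Filter.liminf_nat_add _ 1).symm.trans
      (Filter.liminf_congr
        (Filter.Eventually.of_forall (staggeredSum_torusPullback_two_mul_succ G)))
  exact Iff.of_eq (congrArg (fun r : ℝ => 0 < r) hlim)

end Literature.MathematicalPhysics.QuantumLattice
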